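import Mathlib
import Summits.NavierStokesRegularity.NavierStokesRegularity.Theorems.LerayQuarterDissipationFiniteDissipationLiouvilleSmallDissipationGap
import Summits.NavierStokesRegularity.NavierStokesRegularity.Theorems.LerayQuarterDissipationFiniteDissipationLiouvilleSmallDissipationGapSharperBudget
import HarnessLib

/-!
# Small-dissipation gap for the finite-dissipation stratum, SHARPER CONSTANT, file 3/3: the Liouville
  theorem for `√(max K 0)·(√K_S)³ < (64/27)^{1/4}` (route `LerayQuarterDissipation`, crux
  `FiniteDissipationLiouville` stmt-NavierStokesRegularity-22144, BC5 rung `stub_smallDissipationGap`;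
  lead prover g14, helper)

HONEST FRAMING. A Liouville statement about a HYPOTHETICAL object — a Type-I ancient mild solution in
the Koch–Nadirashvili–Seregin–Šverák gauge (`IsTypeIAncientMild C V`) whose slices obey the GLOBAL
quarter-rate dissipation law `∫ ‖DV(t)‖² ≤ K/√(−t)`: IF `(√(max K 0) · (√K_S)³)⁴ < 64/27`
(`K_S = SNormLESNormFDerivOfEqConst ℝ³ volume 2`, Mathlib's Gagliardo–Nirenberg–Sobolev constant of
`Ḣ¹(ℝ³) ⊂ L⁶`) THEN `V ≡ 0` on `t < 0` (`eq_zero_of_small_dissipation_sharper`). It sharpens the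
tree's `eq_zero_of_small_dissipation` (`√(max K 0)·(√K_S)³ ≤ 2/3`, seat ns-lqd-p2): the admissible
dissipation constant grows by the factor `(64/27)^{1/2}/(4/9) = 2√3 ≈ 3.46`. It is still only the
"first rung" (small-`K` members of the stratum `𝒟`); it says nothing about larger `K`, nothing about
the crux itself for `C > 1 + ε(K)`, and NOTHING about Navier–Stokes regularity or blow-up.

PROOF. `lerayVorticity_eq_zero_of_budget`: ANY budget `Z_R' ≤ −κ Z_R + (L/R)∫_{B̄_{2R}}‖Ω‖²` with
`κ > 0` on the ancient similarity orbit forces `Ω ≡ 0` (the tree's argument for `κ = 1/6`, verbatim with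
a free `κ`: backward ODE bound `le_div_of_deriv_le_neg_mul_add`, then `R → ∞`); the budget is
`deriv_sqCutoffEnstrophy_le_sharper` (file 2/3) fed with the scale-invariant slice bound
`∫‖DU(s)‖² ≤ max K 0` (`integrable_sq_norm_fderiv_lerayOrbit`); curl-free + divergence-free + bounded
slices are constant and the Oseen gauge kills constants. [folklore energy method; Ladyzhenskaya's
inequality; KNSS 2009 Remark 6.1 for the gauge]
-/

noncomputable section

set_option linter.dupNamespace false

namespace Summit.NavierStokesRegularity.NavierStokesRegularity.Theorems.SmallDissipationGap

open MeasureTheory Set Filter Topology Metric InnerProductSpace Function Real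
open scoped RealInnerProductSpace Laplacian ContDiff
open Literature.Analysis Literature.Analysis.FluidPDE
open Summit.NavierStokesRegularity.NavierStokesRegularity.Theorems
open Summit.NavierStokesRegularity.NavierStokesRegularity.Theorems.GaussianGap
open Summit.NavierStokesRegularity.NavierStokesRegularity.Theorems.SimilarityEnstrophy

variable {C : ℝ} {V : ℝ → (EuclideanSpace ℝ (Fin 3)) → (EuclideanSpace ℝ (Fin 3))}

/-- **Any damped localised enstrophy budget on the ancient orbit kills the vorticity.** For a
KNSS-gauge Type-I field `V` with the dissipation law `∫‖DV(t)‖² ≤ K/√(−t)`: if for some `κ > 0`,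
`L ≥ 0` the squared-cutoff enstrophies obey `Z_R' ≤ −κ Z_R + (L/R)∫_{B̄_{2R}}‖Ω‖²` for all `R ≥ 1`
and all `s`, then `Ω ≡ 0`. (`M = ‖curlCLM‖² max K 0 ≥ ∫‖Ω(s)‖²`; the backward ODE bound for the
ANCIENT orbit gives `∫_{B̄_R}‖Ω(s)‖² ≤ Z_R(s) ≤ LM/(κR)`; `R → ∞`.) The tree's
`lerayVorticity_eq_zero_of_small_dissipation` is the case `κ = 1/6`. [folklore energy method] -/
theorem lerayVorticity_eq_zero_of_budget (hV : IsTypeIAncientMild C V) {K : ℝ}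
    (hK : ∀ t : ℝ, t < 0 → ∫⁻ x, ‖fderiv ℝ (V t) x‖ₑ ^ 2 ≤ ENNReal.ofReal (K / Real.sqrt (-t)))
    {κ L : ℝ} (hκ : 0 < κ) (hL0 : 0 ≤ L)
    (hL : ∀ R : ℝ, 1 ≤ R → ∀ s : ℝ,
      deriv (fun σ => ∫ y, smoothTransition (2 - ‖y‖ ^ 2 / R ^ 2) ^ 2 * ‖lerayVorticity V σ y‖ ^ 2) s ≤
        -κ * (∫ y, smoothTransition (2 - ‖y‖ ^ 2 / R ^ 2) ^ 2 * ‖lerayVorticity V s y‖ ^ 2) +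
          L / R * ∫ y in closedBall (0 : (EuclideanSpace ℝ (Fin 3))) (2 * R), ‖lerayVorticity V s y‖ ^ 2) :
    ∀ s y, lerayVorticity V s y = 0 := by
  have hΩ := fun s => integrable_sq_norm_lerayVorticity hV hK s
  set M : ℝ := ‖curlCLM‖ ^ 2 * max K 0 with hMdef
  have hM0 : 0 ≤ M := by positivity
  -- Step 1: `Z_R(s) ≤ L M / (κ R)` for every `R ≥ 1` and every `s`
  have hZ : ∀ R : ℝ, 1 ≤ R → ∀ s : ℝ,
      (∫ y, smoothTransition (2 - ‖y‖ ^ 2 / R ^ 2) ^ 2 * ‖lerayVorticity V s y‖ ^ 2) ≤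
        (L / R * M) / κ := by
    intro R hR1
    have hR : 0 < R := lt_of_lt_of_le one_pos hR1
    have hd : Differentiable ℝ fun σ =>
        ∫ y, smoothTransition (2 - ‖y‖ ^ 2 / R ^ 2) ^ 2 * ‖lerayVorticity V σ y‖ ^ 2 :=
      fun σ => (hasDerivAt_sqCutoffEnstrophy hV hR σ).differentiableAt
    have hle : ∀ σ, (∫ y, smoothTransition (2 - ‖y‖ ^ 2 / R ^ 2) ^ 2 * ‖lerayVorticity V σ y‖ ^ 2) ≤ M := by
      intro σ
      calc (∫ y, smoothTransition (2 - ‖y‖ ^ 2 / R ^ 2) ^ 2 * ‖lerayVorticity V σ y‖ ^ 2)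
          ≤ ∫ y, ‖lerayVorticity V σ y‖ ^ 2 := by
            refine integral_mono_of_nonneg (Eventually.of_forall fun y =>
              mul_nonneg (sq_nonneg _) (sq_nonneg _)) (hΩ σ).1 (Eventually.of_forall fun y => ?_)
            have h1 := sqCutoff_le_one R y
            have h0 : 0 ≤ ‖lerayVorticity V σ y‖ ^ 2 := sq_nonneg _
            nlinarith
        _ ≤ M := (hΩ σ).2
    have hI : ∀ σ, (∫ y in closedBall (0 : EuclideanSpace ℝ (Fin 3)) (2 * R), ‖lerayVorticity V σ y‖ ^ 2) ≤ M :=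
      fun σ => (setIntegral_le_integral (hΩ σ).1 (Eventually.of_forall fun y => sq_nonneg _)).trans (hΩ σ).2
    have hZ' : ∀ σ, deriv (fun σ' =>
        ∫ y, smoothTransition (2 - ‖y‖ ^ 2 / R ^ 2) ^ 2 * ‖lerayVorticity V σ' y‖ ^ 2) σ ≤
        -κ * (∫ y, smoothTransition (2 - ‖y‖ ^ 2 / R ^ 2) ^ 2 * ‖lerayVorticity V σ y‖ ^ 2) +
          L / R * M := by
      intro σ
      refine (hL R hR1 σ).trans ?_
      have := mul_le_mul_of_nonneg_left (hI σ) (div_nonneg hL0 hR.le)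
      linarith
    exact le_div_of_deriv_le_neg_mul_add hd ⟨M, hle⟩ hκ hZ'
  -- Step 2: `∫_{B̄_n} ‖Ω(s)‖² ≤ L M / (κ n)`, and the limit `n → ∞`
  intro s
  have hcΩ : Continuous (lerayVorticity V s) :=
    (signedBudget_contDiff_lerayVorticity_slice hV s (n := 1)).continuous
  have hball : ∀ n : ℕ, 1 ≤ (n : ℝ) →
      (∫ y in closedBall (0 : EuclideanSpace ℝ (Fin 3)) n, ‖lerayVorticity V s y‖ ^ 2) ≤
        (L / n * M) / κ := by
    intro n hn
    have hR : 0 < (n : ℝ) := lt_of_lt_of_le one_pos hn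
    refine le_trans ?_ (hZ n hn s)
    have hint : Integrable fun y => smoothTransition (2 - ‖y‖ ^ 2 / (n : ℝ) ^ 2) ^ 2 *
        ‖lerayVorticity V s y‖ ^ 2 :=
      (((contDiff_sqCutoff (n := 1) (n : ℝ)).continuous).mul (hcΩ.norm.pow 2)).integrable_of_hasCompactSupport
        ((hasCompactSupport_sqCutoff hR).mul_right)
    calc (∫ y in closedBall (0 : EuclideanSpace ℝ (Fin 3)) n, ‖lerayVorticity V s y‖ ^ 2)
        = ∫ y in closedBall (0 : EuclideanSpace ℝ (Fin 3)) n,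
            smoothTransition (2 - ‖y‖ ^ 2 / (n : ℝ) ^ 2) ^ 2 * ‖lerayVorticity V s y‖ ^ 2 := by
          refine setIntegral_congr_fun measurableSet_closedBall fun y hy => ?_
          rw [mem_closedBall, dist_zero_right] at hy
          rw [sqCutoff_eq_one hR hy, one_mul]
      _ ≤ ∫ y, smoothTransition (2 - ‖y‖ ^ 2 / (n : ℝ) ^ 2) ^ 2 * ‖lerayVorticity V s y‖ ^ 2 :=
          setIntegral_le_integral hint (Eventually.of_forall fun y =>
            mul_nonneg (sq_nonneg _) (sq_nonneg _))
  have hlim : Tendsto (fun n : ℕ =>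
      ∫ y in closedBall (0 : EuclideanSpace ℝ (Fin 3)) n, ‖lerayVorticity V s y‖ ^ 2) atTop
      (𝓝 (∫ y, ‖lerayVorticity V s y‖ ^ 2)) := by
    have h := tendsto_setIntegral_of_monotone (μ := (volume : Measure (EuclideanSpace ℝ (Fin 3))))
      (s := fun n : ℕ => closedBall (0 : EuclideanSpace ℝ (Fin 3)) n)
      (f := fun y => ‖lerayVorticity V s y‖ ^ 2) (fun n => measurableSet_closedBall)
      (fun m n hmn => closedBall_subset_closedBall (by exact_mod_cast hmn))
      (by rw [iUnion_closedBall_nat]; exact (hΩ s).1.integrableOn)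
    rwa [iUnion_closedBall_nat, Measure.restrict_univ] at h
  have hlim0 : Tendsto (fun n : ℕ => (L / n * M) / κ) atTop (𝓝 0) := by
    have h := tendsto_const_div_atTop_nhds_zero_nat (L * M / κ)
    refine h.congr fun n => ?_
    ring
  have hE0 : ∫ y, ‖lerayVorticity V s y‖ ^ 2 ≤ 0 :=
    le_of_tendsto_of_tendsto hlim hlim0 (Filter.eventually_atTop.2 ⟨1, fun n hn => hball n
      (by exact_mod_cast hn)⟩)
  have hE : ∫ y, ‖lerayVorticity V s y‖ ^ 2 = 0 :=
    le_antisymm hE0 (integral_nonneg fun y => sq_nonneg _)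
  have hae : (fun y => ‖lerayVorticity V s y‖ ^ 2) =ᵐ[volume] 0 :=
    (integral_eq_zero_iff_of_nonneg (fun y => sq_nonneg _) (hΩ s).1).1 hE
  have hev : (fun y => ‖lerayVorticity V s y‖ ^ 2) = fun _ => (0 : ℝ) :=
    ((hcΩ.norm.pow 2).ae_eq_iff_eq (μ := volume) continuous_const).1 hae
  intro y
  have hy := congrFun hev y
  have : ‖lerayVorticity V s y‖ = 0 := pow_eq_zero_iff (n := 2) (by norm_num) |>.1 hy
  exact norm_eq_zero.1 this

/-- **The similarity vorticity vanishes below the sharper threshold.** For a KNSS-gauge Type-I field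
`V` with the dissipation law `∫‖DV(t)‖² ≤ K/√(−t)` and `(√(max K 0) · (√K_S)³)⁴ < 64/27`: `Ω ≡ 0`
(scale invariance `∫‖DU(s)‖² ≤ max K 0`, the budget `deriv_sqCutoffEnstrophy_le_sharper`, and
`lerayVorticity_eq_zero_of_budget`). [folklore energy method] -/
theorem lerayVorticity_eq_zero_of_small_dissipation_sharper (hV : IsTypeIAncientMild C V) {K : ℝ}
    (hK : ∀ t : ℝ, t < 0 → ∫⁻ x, ‖fderiv ℝ (V t) x‖ₑ ^ 2 ≤ ENNReal.ofReal (K / Real.sqrt (-t)))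
    (hθ : (Real.sqrt (max K 0) *
      Real.sqrt (SNormLESNormFDerivOfEqConst (EuclideanSpace ℝ (Fin 3))
        (volume : Measure (EuclideanSpace ℝ (Fin 3))) 2 : ℝ) ^ 3) ^ 4 < 64 / 27) :
    ∀ s y, lerayVorticity V s y = 0 := by
  have hDU := fun s => integrable_sq_norm_fderiv_lerayOrbit hV hK s
  obtain ⟨κ, hκ, L, hL0, hL⟩ := deriv_sqCutoffEnstrophy_le_sharper hV (KU := max K 0)
    (fun s => (hDU s).1) (fun s => (hDU s).2) hθ
  exact lerayVorticity_eq_zero_of_budget hV hK hκ hL0 hL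

/-- **The small-dissipation Liouville theorem for the finite-dissipation stratum, sharper constant.**
A Type-I ancient mild solution in the KNSS gauge whose slices obey the quarter-rate dissipation law
`∫‖DV(t)‖² ≤ K/√(−t)` with `(√(max K 0)·(√K_S)³)⁴ < 64/27` vanishes identically on `t < 0`:
`Ω ≡ 0` (`lerayVorticity_eq_zero_of_small_dissipation_sharper`), so every slice is curl- and
divergence-free and bounded, hence constant (`eq_of_curl_eq_zero_of_isDivFree_of_bounded`), and the
Oseen gauge kills spatially constant slices (`IsTypeIAncientMild.eq_zero_of_slice_const`). In
particular the threshold `√(max K 0)·(√K_S)³ ≤ 2/3` of `eq_zero_of_small_dissipation` is relaxed to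
`< (64/27)^{1/4} ≈ 1.2408`. HONEST FRAMING: a Liouville statement about a HYPOTHETICAL class; nothing
here bears on NS regularity. [folklore energy method] -/
theorem eq_zero_of_small_dissipation_sharper (hV : IsTypeIAncientMild C V) {K : ℝ}
    (hK : ∀ t : ℝ, t < 0 → ∫⁻ x, ‖fderiv ℝ (V t) x‖ₑ ^ 2 ≤ ENNReal.ofReal (K / Real.sqrt (-t)))
    (hθ : (Real.sqrt (max K 0) *
      Real.sqrt (SNormLESNormFDerivOfEqConst (EuclideanSpace ℝ (Fin 3))
        (volume : Measure (EuclideanSpace ℝ (Fin 3))) 2 : ℝ) ^ 3) ^ 4 < 64 / 27) :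
    ∀ t < 0, ∀ x, V t x = 0 := by
  have hΩ0 := lerayVorticity_eq_zero_of_small_dissipation_sharper hV hK hθ
  have hcurl : ∀ t < 0, ∀ x, curl (V t) x = 0 := by
    intro t ht x
    set s : ℝ := -Real.log (-t) with hs
    have hts : -Real.exp (-s) = t := by
      rw [hs, neg_neg, Real.exp_log (neg_pos.2 ht), neg_neg]
    have h := hΩ0 s ((Real.exp (-s / 2))⁻¹ • x)
    rw [lerayVorticity_apply, curl_lerayOrbit, smul_smul,
      mul_inv_cancel₀ (Real.exp_pos _).ne', one_smul, hts, smul_eq_zero] at h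
    exact h.resolve_left (Real.exp_pos _).ne'
  have hconst : ∀ t < 0, ∀ x, V t x = V t 0 := fun t ht x =>
    eq_of_curl_eq_zero_of_isDivFree_of_bounded ((hV.contDiff_slice ht).of_le (by norm_cast))
      (hcurl t ht) (hV.isDivFree ht) (fun z => hV.norm_le ht z) x 0
  exact fun t ht x => hV.eq_zero_of_slice_const (b := fun t => V t 0) hconst ht x

/-- **Corollary: the explicit small-dissipation rung of the crux, sharper constant.** Under the
dissipation law with `(√(max K 0)·(√K_S)³)⁴ < 64/27` NO member of the stratum is singular at the
apex: the field vanishes, so `‖V t x‖ = 0 < M` fails for `M = 0`. (The crux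
`FiniteDissipationLiouville C K` restricted to these `K`, for every Type-I constant `C`.) -/
theorem not_singular_of_small_dissipation_sharper (hV : IsTypeIAncientMild C V) {K : ℝ}
    (hK : ∀ t : ℝ, t < 0 → ∫⁻ x, ‖fderiv ℝ (V t) x‖ₑ ^ 2 ≤ ENNReal.ofReal (K / Real.sqrt (-t)))
    (hθ : (Real.sqrt (max K 0) *
      Real.sqrt (SNormLESNormFDerivOfEqConst (EuclideanSpace ℝ (Fin 3))
        (volume : Measure (EuclideanSpace ℝ (Fin 3))) 2 : ℝ) ^ 3) ^ 4 < 64 / 27) :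
    ¬ (∀ r > 0, ∀ M : ℝ, ∃ t ∈ Set.Ioo (-(r ^ 2)) (0 : ℝ),
        ∃ x ∈ Metric.ball (0 : EuclideanSpace ℝ (Fin 3)) r, M < ‖V t x‖) := by
  intro h
  obtain ⟨t, ht, x, -, hM⟩ := h 1 one_pos 0
  have h0 := eq_zero_of_small_dissipation_sharper hV hK hθ t ht.2 x
  rw [h0, norm_zero] at hM
  exact lt_irrefl _ hM

end Summit.NavierStokesRegularity.NavierStokesRegularity.Theorems.SmallDissipationGap

end
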